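import Mathlib
import Summits.NavierStokesRegularity.NavierStokesRegularity.Theorems.L3TimeExponentPincerRingDatumEnergy
import Summits.NavierStokesRegularity.NavierStokesRegularity.Theorems.L3TimeExponentPincerRingPersistence
import HarnessLib.Audit
import HarnessLib

/-!
# L3TimeExponentPincer — ring persistence holds: `LpPersistence 3 (1/2) 2`, hence the uniform
# quantitative jaw `QuantJaw q` is false for every `q > 4` (unconditional)

Support kernel for the crux `L3CascadeJaw` (item stmt-NavierStokesRegularity-19499).  Closes the
ROUND-11/12 programme of seat nsreg-p2 («the jaw has no constant»): the typed ring Persistence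
Lemma `LpPersistence 3 (1/2) 2` of `…QuantJaw` is PROVED by feeding the explicit glued-dipole ring
datum (`…RingDatumBounds`, `…RingDatumEnergy`) into `lpPersistence_of_ringData`
(`…RingPersistence`).  Scales: `ℓ = t²`, core `a = t⁴`, outer `16`, cutoff `32`, strength
`κ = c_E t³` with `c_E = 1/(1 + 6656 I₆)` (energy `≤ 1`), and the persistence constant
`c = c_E / (2³¹ Φ⁴ (1 + V₁)²)` (`Φ = max Φ₀ 1` a bound of `|φ'|`, `V₁ = volume.real (ball 0 1)`,
`I₆ = (∫⁻ (1+‖y‖)^{-6}).toReal`); the datum letters are `M = 4Φκ/t¹⁰`, `m = 128ΦκV₁/t⁴`,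
`m⁻ = ΦκV₁`, `P = 128ΦκV₁`, `E = κ²V₁/(144000 t⁶) = c_E²V₁/144000`, and the three scale
inequalities (window, energy, floor) are the real-arithmetic lemmas of §A.

* `lpPersistence_three_half_two : LpPersistence 3 (1/2) 2`;
* `not_quantJaw : 4 < q → ¬ QuantJaw q` (by `not_quantJaw_of_ringPersistence`); `not_quantJaw_five`.

WHAT THIS IS NOT: not NS regularity or blow-up.  It says only that no bound
`∫₀ᵀ‖u‖₃^q ≤ B(E₀, ν, T)` uniform over Schwartz-class data of a given energy can hold for `q > 4`
(viscous vortex rings idle for `≍ Re` turnovers); the crux `L3CascadeJaw` (a statement about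
blow-up solutions) and the data-critical jaw `QuantJawData` are untouched; no crux claim.
-/

namespace Summit.NavierStokesRegularity.NavierStokesRegularity.Theorems.L3TimeExponentPincerRingPersistenceHolds

open Real Set Metric MeasureTheory Literature.Analysis.FluidPDE Literature.Analysis.Calculus
open Summit.NavierStokesRegularity.NavierStokesRegularity.Theorems.L3TimeExponentPincerQuantJaw
open Summit.NavierStokesRegularity.NavierStokesRegularity.Theorems.L3TimeExponentPincerRingPersistence
open Summit.NavierStokesRegularity.NavierStokesRegularity.Theorems.L3TimeExponentPincerRingDatumBounds
open Summit.NavierStokesRegularity.NavierStokesRegularity.Theorems.L3TimeExponentPincerRingDatumEnergy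
open Summit.NavierStokesRegularity.NavierStokesRegularity.Theorems.L3TimeExponentPincerRingDatumDecayIntegral
open scoped ENNReal ContDiff Topology

/-! ### A. Real arithmetic: fourth roots and the three scale inequalities -/

/-- `X⁴ ≤ Y`, `X, Y ≥ 0` ⇒ `X ≤ √(√Y)`. -/
theorem le_sqrt_sqrt_of_pow_four_le {X Y : ℝ} (hX : 0 ≤ X) (hY : 0 ≤ Y) (h : X ^ 4 ≤ Y) :
    X ≤ Real.sqrt (Real.sqrt Y) := by
  rw [Real.le_sqrt hX (Real.sqrt_nonneg _), Real.le_sqrt (sq_nonneg _) hY]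
  calc (X ^ 2) ^ 2 = X ^ 4 := by ring
    _ ≤ Y := h

/-- **Window inequality from fourth powers**: if `(24cτ)⁴ · M²m · (m⁻)² ≤ 2P` (all letters `≥ 0`)
then `2(cτ)·6√(M√m)√(m⁻) ≤ √(√(2P))/2`. -/
theorem window_of_pow_four_le {c τ M m mneg P : ℝ} (hc : 0 ≤ c) (hτ : 0 ≤ τ) (hM : 0 ≤ M)
    (hm : 0 ≤ m) (hmneg : 0 ≤ mneg) (hP : 0 ≤ P)
    (h : (24 * c * τ) ^ 4 * (M ^ 2 * m) * mneg ^ 2 ≤ 2 * P) :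
    2 * (c * τ) * (6 * Real.sqrt (M * Real.sqrt m) * Real.sqrt mneg) ≤
      Real.sqrt (Real.sqrt (2 * P)) / 2 := by
  rw [le_div_iff₀ (by norm_num : (0 : ℝ) < 2)]
  have hMm : 0 ≤ M * Real.sqrt m := mul_nonneg hM (Real.sqrt_nonneg _)
  set X := 2 * (c * τ) * (6 * Real.sqrt (M * Real.sqrt m) * Real.sqrt mneg) * 2 with hX
  have hX0 : 0 ≤ X := by rw [hX]; positivity
  have hX4 : X ^ 4 = (24 * c * τ) ^ 4 * (M ^ 2 * m) * mneg ^ 2 := by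
    have h1 : Real.sqrt (M * Real.sqrt m) ^ 2 = M * Real.sqrt m := Real.sq_sqrt hMm
    have h2 : Real.sqrt mneg ^ 2 = mneg := Real.sq_sqrt hmneg
    have h3 : Real.sqrt m ^ 2 = m := Real.sq_sqrt hm
    calc X ^ 4 = (24 * c * τ) ^ 4 * (Real.sqrt (M * Real.sqrt m) ^ 2) ^ 2 * (Real.sqrt mneg ^ 2) ^ 2 := by
          rw [hX]; ring
      _ = (24 * c * τ) ^ 4 * (M * Real.sqrt m) ^ 2 * mneg ^ 2 := by rw [h1, h2]
      _ = (24 * c * τ) ^ 4 * (M ^ 2 * m) * mneg ^ 2 := by rw [mul_pow M (Real.sqrt m) 2, h3]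
  exact le_sqrt_sqrt_of_pow_four_le hX0 (by positivity) (hX4 ▸ h)

section Scales

variable {t cE Φ V c κ : ℝ}

/-- The persistence constant `c = c_E/(2³¹Φ⁴(1+V)²)` is in `(0, 1]` and below the three thresholds. -/
theorem const_bounds (hcE : 0 < cE) (hcE1 : cE ≤ 1) (hΦ : 1 ≤ Φ) (hV : 0 < V)
    (hc : c = cE / (2 ^ 31 * Φ ^ 4 * (1 + V) ^ 2)) :
    0 < c ∧ c ≤ 1 ∧ c ≤ 1 / (2 ^ 31 * Φ ^ 4 * (1 + V) ^ 2) ∧ c * Φ ≤ cE / 2 ^ 31 ∧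
      c * Φ ^ 2 ≤ 1 / 2 ^ 31 := by
  have hΦ0 : 0 < Φ := by linarith
  have hD : 0 < 2 ^ 31 * Φ ^ 4 * (1 + V) ^ 2 := by positivity
  have hΦ4 : 1 ≤ Φ ^ 4 := one_le_pow₀ hΦ
  have hV1 : 1 ≤ (1 + V) ^ 2 := by nlinarith
  have hD1 : (2 : ℝ) ^ 31 ≤ 2 ^ 31 * Φ ^ 4 * (1 + V) ^ 2 := by nlinarith [mul_le_mul hΦ4 hV1 zero_le_one (by positivity)]
  refine ⟨by rw [hc]; positivity, ?_, ?_, ?_, ?_⟩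
  · rw [hc, div_le_one hD]; linarith
  · rw [hc]; exact div_le_div_of_nonneg_right hcE1 hD.le
  · -- `cΦ = cE Φ/(2³¹Φ⁴(1+V)²) ≤ cE/2³¹` since `Φ ≤ Φ⁴(1+V)²`
    rw [hc, div_mul_eq_mul_div, div_le_div_iff₀ hD (by norm_num)]
    have h1 : Φ ≤ Φ ^ 4 * (1 + V) ^ 2 := by
      calc Φ = Φ * 1 * 1 := by ring
        _ ≤ Φ * Φ ^ 3 * (1 + V) ^ 2 := by gcongr; exact one_le_pow₀ hΦ
        _ = Φ ^ 4 * (1 + V) ^ 2 := by ring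
    nlinarith [mul_le_mul_of_nonneg_left h1 (by positivity : (0 : ℝ) ≤ cE * 2 ^ 31)]
  · rw [hc, div_mul_eq_mul_div, div_le_div_iff₀ hD (by norm_num)]
    have h1 : Φ ^ 2 ≤ Φ ^ 4 * (1 + V) ^ 2 := by
      calc Φ ^ 2 = Φ ^ 2 * 1 * 1 := by ring
        _ ≤ Φ ^ 2 * Φ ^ 2 * (1 + V) ^ 2 := by gcongr; exact one_le_pow₀ hΦ
        _ = Φ ^ 4 * (1 + V) ^ 2 := by ring
    nlinarith [mul_le_mul h1 hcE1 hcE.le (by positivity)]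

/-- **(W2) energy-scale inequality**: `16 M P (c t⁴) ≤ E`. -/
theorem scale_energy (ht : 0 < t) (hcE : 0 < cE) (hcE1 : cE ≤ 1) (hΦ : 1 ≤ Φ) (hV : 0 < V)
    (hc : c = cE / (2 ^ 31 * Φ ^ 4 * (1 + V) ^ 2)) :
    16 * (4 * Φ * κ / t ^ 10) * (128 * Φ * κ * V) * (c * t ^ 4) ≤ κ ^ 2 * V / (144000 * t ^ 6) := by
  obtain ⟨hc0, -, -, -, hcΦ2⟩ := const_bounds hcE hcE1 hΦ hV hc
  have ht0 : t ≠ 0 := ht.ne'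
  have e1 : 16 * (4 * Φ * κ / t ^ 10) * (128 * Φ * κ * V) * (c * t ^ 4) =
      κ ^ 2 * V / t ^ 6 * (8192 * (c * Φ ^ 2)) := by
    field_simp; ring
  have e2 : κ ^ 2 * V / (144000 * t ^ 6) = κ ^ 2 * V / t ^ 6 * (1 / 144000) := by
    field_simp
  rw [e1, e2]
  refine mul_le_mul_of_nonneg_left ?_ (by positivity)
  nlinarith

/-- **(W1) window inequality**: `2(c t⁴)·6√(M√m)√(m⁻) ≤ √(√(2P))/2`. -/
theorem scale_window (ht : 0 < t) (ht1 : t ≤ 1) (hcE : 0 < cE) (hcE1 : cE ≤ 1) (hΦ : 1 ≤ Φ)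
    (hV : 0 < V) (hc : c = cE / (2 ^ 31 * Φ ^ 4 * (1 + V) ^ 2)) (hκ : κ = cE * t ^ 3) :
    2 * (c * t ^ 4) * (6 * Real.sqrt (4 * Φ * κ / t ^ 10 * Real.sqrt (128 * Φ * κ * V / t ^ 4)) *
        Real.sqrt (Φ * κ * V)) ≤ Real.sqrt (Real.sqrt (2 * (128 * Φ * κ * V))) / 2 := by
  obtain ⟨hc0, hc1, hcD, -, -⟩ := const_bounds hcE hcE1 hΦ hV hc
  have hΦ0 : 0 < Φ := by linarith
  have hκ0 : 0 < κ := by rw [hκ]; positivity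
  have ht0 : t ≠ 0 := ht.ne'
  refine window_of_pow_four_le hc0.le (by positivity) (by positivity) (by positivity) (by positivity)
    (by positivity) ?_
  -- the key numerical inequality `2654208 c⁴ Φ⁴ cE⁴ V² t⁴ ≤ 1`
  have hc4 : c ^ 4 ≤ c := by
    calc c ^ 4 ≤ c ^ 1 := pow_le_pow_of_le_one hc0.le hc1 (by norm_num)
      _ = c := pow_one c
  have hcE4 : cE ^ 4 ≤ 1 := pow_le_one₀ hcE.le hcE1
  have ht4 : t ^ 4 ≤ 1 := pow_le_one₀ ht.le ht1
  have hD : 0 < 2 ^ 31 * Φ ^ 4 * (1 + V) ^ 2 := by positivity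
  have hkey1 : c * Φ ^ 4 * V ^ 2 ≤ 1 / 2 ^ 31 := by
    have h1 : c * Φ ^ 4 * V ^ 2 ≤ Φ ^ 4 * V ^ 2 / (2 ^ 31 * Φ ^ 4 * (1 + V) ^ 2) := by
      calc c * Φ ^ 4 * V ^ 2 = c * (Φ ^ 4 * V ^ 2) := by ring
        _ ≤ 1 / (2 ^ 31 * Φ ^ 4 * (1 + V) ^ 2) * (Φ ^ 4 * V ^ 2) :=
            mul_le_mul_of_nonneg_right hcD (by positivity)
        _ = Φ ^ 4 * V ^ 2 / (2 ^ 31 * Φ ^ 4 * (1 + V) ^ 2) := by ring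
    have h2 : Φ ^ 4 * V ^ 2 / (2 ^ 31 * Φ ^ 4 * (1 + V) ^ 2) ≤ 1 / 2 ^ 31 := by
      rw [div_le_div_iff₀ hD (by norm_num)]
      have : V ^ 2 ≤ (1 + V) ^ 2 := by nlinarith
      nlinarith [mul_le_mul_of_nonneg_left this (by positivity : (0 : ℝ) ≤ 2 ^ 31 * Φ ^ 4)]
    exact h1.trans h2
  have hkey : 2654208 * c ^ 4 * Φ ^ 4 * cE ^ 4 * V ^ 2 * t ^ 4 ≤ 1 := by
    have h3 : c ^ 4 * Φ ^ 4 * cE ^ 4 * V ^ 2 * t ^ 4 ≤ c * Φ ^ 4 * V ^ 2 := by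
      calc c ^ 4 * Φ ^ 4 * cE ^ 4 * V ^ 2 * t ^ 4
          ≤ c * Φ ^ 4 * 1 * V ^ 2 * 1 := by gcongr
        _ = c * Φ ^ 4 * V ^ 2 := by ring
    nlinarith
  calc (24 * c * t ^ 4) ^ 4 * ((4 * Φ * κ / t ^ 10) ^ 2 * (128 * Φ * κ * V / t ^ 4)) * (Φ * κ * V) ^ 2
      = 2654208 * c ^ 4 * Φ ^ 4 * cE ^ 4 * V ^ 2 * t ^ 4 * (2 * (128 * Φ * κ * V)) := by
        rw [hκ]; field_simp; ring
    _ ≤ 1 * (2 * (128 * Φ * κ * V)) := mul_le_mul_of_nonneg_right hkey (by positivity)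
    _ = 2 * (128 * Φ * κ * V) := one_mul _

/-- **(F) floor inequality**: `c t⁻¹ ≤ (π(E/2)³/(512(√m√(4P))³))^{1/3}`. -/
theorem scale_floor (ht : 0 < t) (hcE : 0 < cE) (hcE1 : cE ≤ 1) (hΦ : 1 ≤ Φ) (hV : 0 < V)
    (hc : c = cE / (2 ^ 31 * Φ ^ 4 * (1 + V) ^ 2)) (hκ : κ = cE * t ^ 3) :
    c * t⁻¹ ≤ (π * (κ ^ 2 * V / (144000 * t ^ 6) / 2) ^ 3 /
      (512 * (Real.sqrt (128 * Φ * κ * V / t ^ 4) * Real.sqrt (4 * (128 * Φ * κ * V))) ^ 3)) ^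
        (1 / 3 : ℝ) := by
  obtain ⟨hc0, -, -, hcΦ, -⟩ := const_bounds hcE hcE1 hΦ hV hc
  have hΦ0 : 0 < Φ := by linarith
  have hκ0 : 0 < κ := by rw [hκ]; positivity
  have ht0 : t ≠ 0 := ht.ne'
  -- `√m √(4P) = 256 Φ κ V / t²`
  have hS : Real.sqrt (128 * Φ * κ * V / t ^ 4) * Real.sqrt (4 * (128 * Φ * κ * V)) =
      256 * Φ * κ * V / t ^ 2 := by
    rw [← Real.sqrt_mul (by positivity)]
    have e : 128 * Φ * κ * V / t ^ 4 * (4 * (128 * Φ * κ * V)) = (256 * Φ * κ * V / t ^ 2) ^ 2 := by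
      field_simp; ring
    rw [e, Real.sqrt_sq (by positivity)]
  rw [hS, ← div_eq_mul_inv]
  -- cube roots: `X ≤ Q^{1/3}` from `X³ ≤ Q` (`X = c/t ≥ 0`)
  have hX : 0 ≤ c / t := by positivity
  have eX : c / t = ((c / t) ^ 3) ^ (1 / 3 : ℝ) := by
    rw [← Real.rpow_natCast, ← Real.rpow_mul hX]; norm_num
  rw [eX]
  refine Real.rpow_le_rpow (by positivity) ?_ (by norm_num)
  rw [le_div_iff₀ (by positivity)]
  -- `(c/t)³ · 512 (256ΦκV/t²)³ = 2³³ (cΦ)³ cE³ V³ ≤ 2³³ (cE/2³¹)³ cE³ V³ = cE⁶ V³/2⁶⁰ ≤ π cE⁶V³/288000³`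
  have e1 : (c / t) ^ 3 * (512 * (256 * Φ * κ * V / t ^ 2) ^ 3) =
      2 ^ 33 * (c * Φ) ^ 3 * cE ^ 3 * V ^ 3 := by
    rw [hκ]; field_simp; ring
  have e2 : π * (κ ^ 2 * V / (144000 * t ^ 6) / 2) ^ 3 = π * (cE ^ 6 * V ^ 3) / 288000 ^ 3 := by
    rw [hκ]; field_simp; ring
  rw [e1, e2]
  have h1 : (c * Φ) ^ 3 ≤ (cE / 2 ^ 31) ^ 3 := pow_le_pow_left₀ (by positivity) hcΦ 3
  have hπ : (1 : ℝ) ≤ π := by linarith [Real.pi_gt_three]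
  have h2 : 2 ^ 33 * (cE / 2 ^ 31) ^ 3 * cE ^ 3 * V ^ 3 ≤ π * (cE ^ 6 * V ^ 3) / 288000 ^ 3 := by
    rw [le_div_iff₀ (by norm_num)]
    have h3 : 2 ^ 33 * (cE / 2 ^ 31) ^ 3 * cE ^ 3 * V ^ 3 * 288000 ^ 3 =
        (288000 ^ 3 / 2 ^ 60) * (cE ^ 6 * V ^ 3) := by ring
    rw [h3]
    exact mul_le_mul_of_nonneg_right (by norm_num; linarith) (by positivity)
  calc 2 ^ 33 * (c * Φ) ^ 3 * cE ^ 3 * V ^ 3 ≤ 2 ^ 33 * (cE / 2 ^ 31) ^ 3 * cE ^ 3 * V ^ 3 := by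
        gcongr
    _ ≤ _ := h2

/-- **Energy normalisation**: `(6656/9) c_E² I₆ ≤ 1` for `c_E = 1/(1 + 6656 I₆)`. -/
theorem energy_const_le_one {i : ℝ} (hi : 0 ≤ i) (hcE : cE = 1 / (1 + 6656 * i)) :
    6656 / 9 * cE ^ 2 * i ≤ 1 := by
  have hd : 0 < 1 + 6656 * i := by positivity
  have hcE0 : 0 < cE := by rw [hcE]; positivity
  have hcE1 : cE ≤ 1 := by rw [hcE, div_le_one hd]; linarith
  have hid : cE * (1 + 6656 * i) = 1 := by rw [hcE]; field_simp
  have h1 : cE ^ 2 * i ≤ cE * i := by nlinarith [mul_nonneg hcE0.le hi]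
  nlinarith [mul_nonneg hcE0.le hi]

end Scales

/-! ### B. The theorem -/

/-- **Ring persistence: `LpPersistence 3 (1/2) 2` holds.**  For every scale `ℓ ∈ (0, 1]` the
Tao-class solution (`ν = 1`) from the explicit glued-dipole ring datum of core scale `ℓ²` and
energy `≤ 1` keeps `‖u(t)‖₃ ≥ c ℓ^{-1/2}` throughout `(0, c ℓ²)`, with one absolute `c ∈ (0, 1]`. -/
theorem lpPersistence_three_half_two : LpPersistence 3 (1 / 2) 2 := by
  -- the absolute letters `Φ`, `V`, `I₆` and constants `c_E`, `c`
  obtain ⟨Φ₀, -, hΦ₀⟩ := exists_bound_deriv_smoothTransition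
  obtain ⟨Φ, hΦ1, hΦ⟩ : ∃ Φ : ℝ, 1 ≤ Φ ∧ ∀ τ, |deriv Real.smoothTransition τ| ≤ Φ :=
    ⟨max Φ₀ 1, le_max_right _ _, fun τ => (hΦ₀ τ).trans (le_max_left _ _)⟩
  have hΦ0 : 0 < Φ := by linarith
  obtain ⟨V, hVdef⟩ : ∃ V : ℝ, V = (volume (ball (0 : EuclideanSpace ℝ (Fin 3)) 1)).toReal := ⟨_, rfl⟩
  have hV : 0 < V := by
    rw [hVdef]
    exact ENNReal.toReal_pos (measure_ball_pos volume _ one_pos).ne' measure_ball_lt_top.ne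
  set I : ℝ≥0∞ := ∫⁻ y : EuclideanSpace ℝ (Fin 3), ENNReal.ofReal ((1 + ‖y‖) ^ (-(6 : ℝ))) with hIdef
  have hI : I ≠ ⊤ := lintegral_one_add_norm_rpow_neg_six_lt_top.ne
  obtain ⟨i, hidef⟩ : ∃ i : ℝ, i = I.toReal := ⟨_, rfl⟩
  have hi : 0 ≤ i := by rw [hidef]; exact ENNReal.toReal_nonneg
  have hIi : I = ENNReal.ofReal i := by rw [hidef, ENNReal.ofReal_toReal hI]
  obtain ⟨cE, hcEdef⟩ : ∃ cE : ℝ, cE = 1 / (1 + 6656 * i) := ⟨_, rfl⟩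
  have hcE : 0 < cE := by rw [hcEdef]; positivity
  have hcE1 : cE ≤ 1 := by
    rw [hcEdef, div_le_one (by positivity)]; linarith
  obtain ⟨c, hcdef⟩ : ∃ c : ℝ, c = cE / (2 ^ 31 * Φ ^ 4 * (1 + V) ^ 2) := ⟨_, rfl⟩
  obtain ⟨hc0, hc1, -, -, -⟩ := const_bounds hcE hcE1 hΦ1 hV hcdef
  refine lpPersistence_of_ringData hc0 hc1 fun ℓ hℓ hℓ1 => ?_
  -- `ℓ = t²`, `0 < t ≤ 1`
  obtain ⟨t, ht, ht1, rfl⟩ : ∃ t : ℝ, 0 < t ∧ t ≤ 1 ∧ ℓ = t ^ 2 :=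
    ⟨Real.sqrt ℓ, Real.sqrt_pos.2 hℓ, by simpa using Real.sqrt_le_sqrt hℓ1, (Real.sq_sqrt hℓ.le).symm⟩
  have ht0 : t ≠ 0 := ht.ne'
  have hℓ2 : (t ^ 2) ^ (2 : ℝ) = t ^ 4 := by rw [Real.rpow_two]; ring
  have hℓh : (t ^ 2) ^ (-(1 / 2 : ℝ)) = t⁻¹ := by
    rw [Real.rpow_neg (sq_nonneg t), ← Real.sqrt_eq_rpow, Real.sqrt_sq ht.le]
  -- strength, shape, potential
  obtain ⟨κ, hκ⟩ : ∃ κ : ℝ, κ = cE * t ^ 3 := ⟨_, rfl⟩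
  have hκ0 : 0 < κ := by rw [hκ]; positivity
  obtain ⟨G, hG⟩ : ∃ G : ℝ → ℝ, G = fun s => -κ * (Real.smoothTransition (s / t ^ 4 - 1) -
      Real.smoothTransition (s / 16 - 1)) := ⟨_, rfl⟩
  obtain ⟨F, hF⟩ : ∃ F : ℝ → ℝ, F = fun s => ∫ τ in (32 : ℝ)..s, τ ^ (-(5 / 2 : ℝ)) * G τ := ⟨_, rfl⟩
  obtain ⟨hsm, hdiv, hdec, hax, hsw⟩ := ringDatum_frame hG hF ht ht1
  have hM := ringDatum_abs_eta_le hG hF ht ht1 hκ0.le hΦ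
  have ht4 : t ^ 4 ≤ 1 := pow_le_one₀ ht.le ht1
  refine ⟨curl fun y : EuclideanSpace ℝ (Fin 3) => F (‖y‖ ^ 2) • rotGen y, 4 * Φ * κ / t ^ 10,
    128 * Φ * κ * V / t ^ 4, Φ * κ * V, 128 * Φ * κ * V, κ ^ 2 * V / (144000 * t ^ 6),
    hsm, hdiv, hdec, hax, hsw, ringDatum_integrable hG hF ht ht1, ?_, hM, ?_, by positivity, ?_,
    by positivity, by positivity, ?_, ?_, by positivity, ?_, ?_, ?_, ?_⟩
  · -- energy `≤ 1`
    refine (ringDatum_energy_le hG hF ht ht1 hκ0.le).trans ?_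
    rw [← hIdef, hIi, ← ENNReal.ofReal_mul (by positivity), ← ENNReal.ofReal_one]
    refine ENNReal.ofReal_le_ofReal ?_
    have e : 6656 / 9 * κ ^ 2 / t ^ 6 * i = 6656 / 9 * cE ^ 2 * i := by
      rw [hκ]; field_simp; try ring
    rw [e]
    exact energy_const_le_one hi hcEdef
  · -- mass `m`
    refine (ringDatum_mass_le hG hF ht ht1 hκ0.le hΦ).trans ?_
    rw [← hVdef]
    have h96 : Φ * κ * V ≤ 96 * Φ * κ * V / t ^ 4 := by
      rw [le_div_iff₀ (by positivity)]
      nlinarith [mul_pos (mul_pos hΦ0 hκ0) hV]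
    have e : 128 * Φ * κ * V / t ^ 4 = 32 * Φ * κ * V / t ^ 4 + 96 * Φ * κ * V / t ^ 4 := by ring
    rw [e]
    linarith
  · rw [hVdef]; exact ringDatum_negPart_le hG hF ht ht1 hκ0.le hΦ
  · rw [hVdef]; exact ringDatum_rsq_posPart_le hG hF ht ht1 hκ0.le hΦ
  · rw [hVdef]; exact ringDatum_rsq_negPart_le hG hF ht ht1 hκ0.le hΦ
  · rw [hVdef]; exact ringDatum_energy_ge hG hF ht ht1 hκ0.le
  · rw [hℓ2]; exact scale_window ht ht1 hcE hcE1 hΦ1 hV hcdef hκ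
  · rw [hℓ2]; exact scale_energy ht hcE hcE1 hΦ1 hV hcdef
  · rw [hℓh]; exact scale_floor ht hcE hcE1 hΦ1 hV hcdef hκ

/-- **The uniform quantitative jaw has no constant: `¬ QuantJaw q` for every `q > 4`** — now
unconditional (`not_quantJaw_of_ringPersistence` fed with `lpPersistence_three_half_two`). -/
theorem not_quantJaw {q : ℝ} (hq : 4 < q) : ¬ QuantJaw q :=
  not_quantJaw_of_ringPersistence lpPersistence_three_half_two hq

/-- In particular the uniform jaw fails at the crux's upper exponent `q = 5` (and at every
`q ∈ (4, 5)`, the crux's range): `¬ QuantJaw 5`. -/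
theorem not_quantJaw_five : ¬ QuantJaw 5 := not_quantJaw (by norm_num)

/--
info: 'Summit.NavierStokesRegularity.NavierStokesRegularity.Theorems.L3TimeExponentPincerRingPersistenceHolds.not_quantJaw' depends on axioms: [propext,
 Classical.choice,
 Quot.sound]
-/
#guard_msgs in
#print axioms not_quantJaw

end Summit.NavierStokesRegularity.NavierStokesRegularity.Theorems.L3TimeExponentPincerRingPersistenceHolds
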